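import Summits.ValiantsHypothesis.ValiantsHypothesis.Theorems.TwoProducts.WronskianSylvester
import Summits.ValiantsHypothesis.ValiantsHypothesis.Theorems.TwoProducts.RankThreeAffineUnitLadder

/-!
# Rank three AFFINE, the WRONSKIAN LADDER (engine of T1-E′): `|Eset σ (Σₖ Uₖ·aₖ)| ≤ flagBound t B 0 |K|` for `J(aₖ,v) = 0` and flag Wronskians with `≤ B i` edge slopes — NO squaring tower

Second engine for the located class «bounded fewnomials» of the OPEN rung 3-AFF of the SIDE ladder «table-rank-ladder» of crux
`stmt-ValiantsHypothesis-5906` (`TwoProducts`) — val-port-1 g5; priced by val-idea-crit-8 g5 VERDICT #87 (S3, «ladder′»); instance + law in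
`…RankThreeAffineWronskianFewnomial`.
THE POINT.  The UNIT LADDER (✓ `card_Eset_unitSum_le`, `…RankThreeAffineUnitLadder`) pivots on one term and SQUARES the coefficient size at every
step (`ladderBound`, exponent `≍ 6^n`).  Here the pivots are the FLAG WRONSKIANS `W_i = W_D(U_{b₀},…,U_{b_{i−1}})` of the units themselves for the
derivation `D = M·J(·,v)` (`unitDer = M • jacDer v`), the residues are `F_i = W_D(U_{b₀},…,U_{b_{i−1}}, E)`, `E = Σₖ Uₖ·aₖ` with `D`-CONSTANT coefficients
`aₖ` (`J(aₖ,v) = 0`: constants `C c` by ✓ `jac_C_left`, or `ψ(v)` for univariate `ψ` by ✓ `jac_aeval_self`), and the SYLVESTER identity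
✓ `wronskian_sylvester` (`…TwoProducts.WronskianSylvester`) reads `M·(W_{i+1}·J(F_i,v) − F_i·J(W_{i+1},v)) = W_i·F_{i+1}` (`wronskian_shift_identity`) —
exactly the input of ✓ `Eset_subset_of_shifted` (`…RankTwoJacobianShiftedSpecials`).  The pivot `b_i` is chosen ADAPTIVELY (`W_{i+1} ≠ 0`; if no
such index exists then `F_i = 0` by column multilinearity `wronskian_snoc_sum` and the repeated-column rule `wronskian_snoc_eq_zero_of_eq`), and the
recursion ends after `≤ |K|` steps (each pivot is a new index of `K`).  Since `D^j U = P_j·U` with `|supp P_j| ≤ (ℓ+μt)^j` (`iterate_unitDer`,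
`card_support_unitIter_le`), `W_i = (Π_c U_{b_c})·det(P_j(b_c))_{j,c}` (`wronskian_units_eq`, `Matrix.det_mul_row`) has
`|Eset σ W_i| ≤ wEB t μ ℓ η i = i·η + (i!·(ℓ+μt+1)^{i·i})²` (`card_Eset_wronskian_units_le`; supports of products / sums / determinants in §2).
RESULTS: ★ `card_Eset_flag_le` — the adaptive flag ladder, ABSTRACT in the family `U` (only a bound `B i` on `|Eset σ W_D(U∘b)|` for flags `b : Fin i → ι` is used;
`flagBound t B`), and ★★ `card_Eset_unitSumW_le : |Eset σ (Σ_{k∈K} Uₖ·aₖ)| ≤ flagBound t (wEB t μ ℓ η) 0 r` for `|K| ≤ r`, tame units and `J(aₖ,v) = 0` — same data as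
✓ `card_Eset_unitSum_le` but `D`-CONSTANT coefficients (of ANY size), and no `Uₖ ≠ 0` needed.  §0 holds the generic column facts for
`Literature.LinearAlgebra.Matrix.wronskian (⇑D)` in its last (`Fin.snoc`) argument (additive / `D`-constant-linear / zero / finite sums / repeated column /
sizes `0`, `1`), for any `Derivation R S S`.
HONEST LABEL: a located-class engine on an OPEN rung; nothing here closes 5906 / `RankThreeAffineLaw` / `OLMLaw` / `PlanarCellBound` / `ResidualLawV25`;
`TwoProducts` OPEN; VP ≠ VNP is NOT proved here or anywhere in this tree.  `--supports stmt-ValiantsHypothesis-5906 --as helper`.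
No instances, no notation, no named facts. [folklore]
-/

noncomputable section
set_option linter.dupNamespace false

/-! ### §0 Column multilinearity of the Wronskian in its last (`snoc`) argument

(`D`-constant multilinearity in the `Fin.snoc` slot; compare the coefficient-`1` column operation ✓ `Literature.LinearAlgebra.Matrix.wronskian_update_sum` and the analytic
cousin ✓ `…KoiranPortierTavenas2015.WronskianZeroBoundsRefined.wronskian_lastCol_sum`.) -/

namespace Summit.ValiantsHypothesis.ValiantsHypothesis.Theorems.TwoProducts.Wronskian

open Matrix
open Literature.LinearAlgebra.Matrix (wronskianMatrix wronskian wronskianMatrix_apply wronskian_def)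

variable {R S : Type*} [CommRing R] [CommRing S] [Algebra R S] (D : Derivation R S S)

/-- The Wronskian matrix of `(f⃗, h)` is that of `(f⃗, 0)` with the last column replaced by `(D^i h)_i`. [folklore] -/
theorem wronskianMatrix_snoc_eq_updateCol {n : ℕ} (f : Fin n → S) (h : S) :
    wronskianMatrix (⇑D) (Fin.snoc f h : Fin (n + 1) → S) =
      (wronskianMatrix (⇑D) (Fin.snoc f 0 : Fin (n + 1) → S)).updateCol (Fin.last n) (fun i => (⇑D)^[(i : ℕ)] h) := by
  ext i j
  rw [updateCol_apply, wronskianMatrix_apply, wronskianMatrix_apply]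
  by_cases hj : j = Fin.last n
  · rw [if_pos hj, hj, Fin.snoc_last]
  · rw [if_neg hj]
    obtain ⟨k, rfl⟩ := Fin.exists_castSucc_eq.mpr hj
    rw [Fin.snoc_castSucc, Fin.snoc_castSucc]

/-- `W(f⃗, 0) = 0`. [folklore] -/
theorem wronskian_snoc_zero {n : ℕ} (f : Fin n → S) : wronskian (⇑D) (Fin.snoc f 0 : Fin (n + 1) → S) = 0 := by
  rw [wronskian_def]
  exact det_eq_zero_of_column_eq_zero (Fin.last n) fun i => by
    rw [wronskianMatrix_apply, Fin.snoc_last, Literature.LinearAlgebra.Matrix.iterate_map_zero D]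

/-- Additivity in the last function: `W(f⃗, x + y) = W(f⃗, x) + W(f⃗, y)`. [folklore] -/
theorem wronskian_snoc_add {n : ℕ} (f : Fin n → S) (x y : S) :
    wronskian (⇑D) (Fin.snoc f (x + y) : Fin (n + 1) → S) =
      wronskian (⇑D) (Fin.snoc f x : Fin (n + 1) → S) + wronskian (⇑D) (Fin.snoc f y : Fin (n + 1) → S) := by
  have hxy : (fun i : Fin (n + 1) => (⇑D)^[(i : ℕ)] (x + y)) =
      (fun i : Fin (n + 1) => (⇑D)^[(i : ℕ)] x) + (fun i : Fin (n + 1) => (⇑D)^[(i : ℕ)] y) := by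
    funext i
    rw [Pi.add_apply, Literature.LinearAlgebra.Matrix.iterate_map_add D]
  rw [wronskian_def, wronskian_def, wronskian_def, wronskianMatrix_snoc_eq_updateCol D f (x + y),
    wronskianMatrix_snoc_eq_updateCol D f x, wronskianMatrix_snoc_eq_updateCol D f y, hxy, det_updateCol_add]

/-- Linearity over `D`-constants in the last function: `W(f⃗, c·x) = c·W(f⃗, x)` if `D c = 0`. [folklore] -/
theorem wronskian_snoc_const_mul {n : ℕ} (f : Fin n → S) (c x : S) (hc : D c = 0) :
    wronskian (⇑D) (Fin.snoc f (c * x) : Fin (n + 1) → S) = c * wronskian (⇑D) (Fin.snoc f x : Fin (n + 1) → S) := by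
  have hcx : (fun i : Fin (n + 1) => (⇑D)^[(i : ℕ)] (c * x)) = c • (fun i : Fin (n + 1) => (⇑D)^[(i : ℕ)] x) := by
    funext i
    rw [Pi.smul_apply, smul_eq_mul, Literature.LinearAlgebra.Matrix.iterate_const_mul D c x hc]
  rw [wronskian_def, wronskian_def, wronskianMatrix_snoc_eq_updateCol D f (c * x), wronskianMatrix_snoc_eq_updateCol D f x, hcx,
    det_updateCol_smul]

/-- ★ **Column multilinearity:** `W(f⃗, Σₖ gₖ·aₖ) = Σₖ aₖ·W(f⃗, gₖ)` for `D`-constants `aₖ`. [folklore] -/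
theorem wronskian_snoc_sum {n : ℕ} (f : Fin n → S) {ι : Type*} (K : Finset ι) (g a : ι → S) (ha : ∀ k ∈ K, D (a k) = 0) :
    wronskian (⇑D) (Fin.snoc f (∑ k ∈ K, g k * a k) : Fin (n + 1) → S) =
      ∑ k ∈ K, a k * wronskian (⇑D) (Fin.snoc f (g k) : Fin (n + 1) → S) := by
  classical
  induction K using Finset.induction_on with
  | empty => rw [Finset.sum_empty, Finset.sum_empty, wronskian_snoc_zero]
  | @insert k K hk ih =>
    rw [Finset.sum_insert hk, Finset.sum_insert hk, wronskian_snoc_add, ih (fun k' hk' => ha k' (Finset.mem_insert_of_mem hk')),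
      mul_comm (g k) (a k), wronskian_snoc_const_mul D f (a k) (g k) (ha k (Finset.mem_insert_self k K))]

/-- **Repeated column:** `W(f⃗, g) = 0` if `g` is one of the `fₐ`. [folklore] -/
theorem wronskian_snoc_eq_zero_of_eq {n : ℕ} (f : Fin n → S) {g : S} {a : Fin n} (ha : f a = g) :
    wronskian (⇑D) (Fin.snoc f g : Fin (n + 1) → S) = 0 := by
  rw [wronskian_def]
  refine det_zero_of_column_eq (i := a.castSucc) (j := Fin.last n) (Fin.castSucc_lt_last a).ne fun k => ?_
  rw [wronskianMatrix_apply, wronskianMatrix_apply, Fin.snoc_castSucc, Fin.snoc_last, ha]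

/-- `W() = 1` (empty family). [folklore] -/
theorem wronskian_fin_zero (f : Fin 0 → S) : wronskian (⇑D) f = 1 := by
  rw [wronskian_def]
  exact det_fin_zero

/-- `W(g) = g` (one function). [folklore] -/
theorem wronskian_fin_one (f : Fin 0 → S) (g : S) : wronskian (⇑D) (Fin.snoc f g : Fin 1 → S) = g := by
  rw [wronskian_def, det_fin_one, wronskianMatrix_apply]
  have h0 : (0 : Fin 1) = Fin.last 0 := rfl
  rw [h0, Fin.snoc_last]
  rfl

end Summit.ValiantsHypothesis.ValiantsHypothesis.Theorems.TwoProducts.Wronskian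

namespace Summit.ValiantsHypothesis.ValiantsHypothesis.Theorems.TwoProducts.RankTwoJacobian

open scoped BigOperators Pointwise Classical
open MvPolynomial
open Literature.LinearAlgebra.Matrix (wronskianMatrix wronskian wronskianMatrix_apply wronskian_def)
open Summit.ValiantsHypothesis.ValiantsHypothesis.Theorems.TwoProducts.Wronskian

/-! ### §1 The unit derivation `D = M·J(·,v)` and its iterates on units -/

/-- the scaled Jacobian derivation `D_{M,v} F = M·J(F, v)` of `ℂ[x,y]` (`= M • jacDer v`) -/
def unitDer (M v : Poly2) : Derivation ℂ Poly2 Poly2 := M • jacDer v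

/-- `D_{M,v} F = M·J(F,v)`. [folklore] -/
theorem unitDer_apply (M v F : Poly2) : unitDer M v F = M * jac F v := by
  rw [unitDer, Derivation.smul_apply, jacDer_apply, smul_eq_mul]

/-- `J(a,v) = 0 ⇒ D_{M,v} a = 0` (e.g. `a = C c` by ✓ `jac_C_left`, `a = ψ(v)` by ✓ `jac_aeval_self`). [folklore] -/
theorem unitDer_eq_zero (M v : Poly2) {a : Poly2} (ha : jac a v = 0) : unitDer M v a = 0 := by
  rw [unitDer_apply, ha, mul_zero]

/-- the iterated unit multipliers `P₀ = 1`, `P_{j+1} = P_j·L + M·J(P_j, v)` (so that `D^j U = P_j·U` for a unit `M·J(U,v) = U·L`) -/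
def unitIter (M v L : Poly2) : ℕ → Poly2
  | 0 => 1
  | j + 1 => dCoeff M v L (unitIter M v L j)

/-- ★ `D_{M,v}^j U = P_j·U` for a unit `U` (`M·J(U,v) = U·L`). [folklore] -/
theorem iterate_unitDer (M v U L : Poly2) (hUL : M * jac U v = U * L) : ∀ j : ℕ, (⇑(unitDer M v))^[j] U = unitIter M v L j * U
  | 0 => by rw [Function.iterate_zero, id, unitIter, one_mul]
  | j + 1 => by
    rw [Function.iterate_succ_apply', iterate_unitDer M v U L hUL j, unitDer_apply, unitIter, mul_comm (unitIter M v L j) U,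
      unit_jac M v U L _ hUL, mul_comm]

/-- `|supp P_j| ≤ (ℓ + μt)^j`. [folklore] -/
theorem card_support_unitIter_le {M v L : Poly2} {t μ ℓ : ℕ} (hvt : v.support.card ≤ t) (hμ : M.support.card ≤ μ)
    (hL : L.support.card ≤ ℓ) : ∀ j : ℕ, (unitIter M v L j).support.card ≤ (ℓ + μ * t) ^ j
  | 0 => by rw [unitIter, pow_zero, MvPolynomial.support_one, Finset.card_singleton]
  | j + 1 => by
    rw [unitIter, pow_succ]
    have h := card_support_dCoeff_le hvt hμ hL (card_support_unitIter_le hvt hμ hL j)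
    have e : (ℓ + μ * t) ^ j * ℓ + μ * ((ℓ + μ * t) ^ j * t) = (ℓ + μ * t) ^ j * (ℓ + μ * t) := by ring
    omega

/-! ### §2 Support sizes of products, sums, determinants; edge count of a product

The three support counts are PRIVATE copies (β2 precedent of `…WronskianSylvester` §2): `card_supp_det_le` = ✓
`Literature.Computability.AlgebraicComplexity.FSV18Lemma53.card_support_det_le` (`Literature/Computability/AlgebraicComplexity/FSV18SparseTrdegLemma53.lean`, FSV18
Lemma 53 step, `Matrix (Fin k) (Fin k) (MvPolynomial σ R)`) = ✓ `Literature.Computability.AlgebraicComplexity.mvPolynomial_card_support_det_le` (`…/FSV18Lemma53Reduction.lean`),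
re-proved here for a `Fintype` index in 10 lines to spare the FSV18 import cone (`IsAlgClosed`, ROABP, Jacobian criterion) — cite those, not these (crit-8 g5 #96 (S3-δ)). -/

/-- `|supp Π_{x∈s} f x| ≤ S^|s|` if every factor has `≤ S` terms.  PRIVATE feeder of `card_supp_det_le` (see §2 header). [folklore] -/
private theorem card_supp_prod_le_pow {α : Type*} (s : Finset α) (f : α → Poly2) {S : ℕ} (hf : ∀ x ∈ s, (f x).support.card ≤ S) :
    (∏ x ∈ s, f x).support.card ≤ S ^ s.card := by
  induction s using Finset.induction_on with
  | empty => rw [Finset.prod_empty, Finset.card_empty, pow_zero, MvPolynomial.support_one, Finset.card_singleton]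
  | @insert a s ha ih =>
    rw [Finset.prod_insert ha, Finset.card_insert_of_notMem ha, pow_succ, mul_comm (S ^ s.card) S]
    exact (card_supp_mul_le _ _).trans
      (Nat.mul_le_mul (hf a (Finset.mem_insert_self a s)) (ih fun x hx => hf x (Finset.mem_insert_of_mem hx)))

/-- `|supp Σ_{x∈s} f x| ≤ |s|·B` if every summand has `≤ B` terms.  PRIVATE feeder of `card_supp_det_le` (see §2 header). [folklore] -/
private theorem card_supp_sum_le_mul {α : Type*} (s : Finset α) (f : α → Poly2) {B : ℕ} (hf : ∀ x ∈ s, (f x).support.card ≤ B) :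
    (∑ x ∈ s, f x).support.card ≤ s.card * B := by
  induction s using Finset.induction_on with
  | empty => simp
  | @insert a s ha ih =>
    rw [Finset.sum_insert ha, Finset.card_insert_of_notMem ha, Nat.succ_mul]
    have h1 := hf a (Finset.mem_insert_self a s)
    have h2 := ih fun x hx => hf x (Finset.mem_insert_of_mem hx)
    have h3 := card_supp_add_le (f a) (∑ x ∈ s, f x)
    omega

/-- `|supp det A| ≤ m!·S^m` for an `m × m` matrix over `ℂ[x,y]` with `≤ S`-term entries (Leibniz expansion).  PRIVATE copy: restates ✓
`Literature.Computability.AlgebraicComplexity.FSV18Lemma53.card_support_det_le` / ✓ `…mvPolynomial_card_support_det_le` (FSV18 Lemma 53) for a `Fintype` index; kept private to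
spare the import cone (cite those). [cite: ForbesShpilkaVolk2018, proof of Lemma 53] -/
private theorem card_supp_det_le {m : Type*} [Fintype m] [DecidableEq m] (A : Matrix m m Poly2) {S : ℕ}
    (hA : ∀ a b, (A a b).support.card ≤ S) : A.det.support.card ≤ (Fintype.card m).factorial * S ^ Fintype.card m := by
  rw [Matrix.det_apply']
  have hterm : ∀ τ : Equiv.Perm m, ((((Equiv.Perm.sign τ : ℤˣ) : ℤ) : Poly2) * ∏ i, A (τ i) i).support.card ≤ S ^ Fintype.card m := by
    intro τ
    rw [← map_intCast (MvPolynomial.C : ℂ →+* Poly2)]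
    refine (card_supp_C_mul_le _ _).trans ?_
    have h := card_supp_prod_le_pow Finset.univ (fun i => A (τ i) i) (fun i _ => hA (τ i) i)
    rwa [Finset.card_univ] at h
  refine (card_supp_sum_le_mul Finset.univ _ (fun τ _ => hterm τ)).trans ?_
  rw [Finset.card_univ, Fintype.card_perm]

/-- `|Eset σ (Π_{x∈s} f x)| ≤ |s|·η` if every factor has `≤ η` edge slopes (✓ `card_Eset_mul_le`). [folklore] -/
theorem card_Eset_prod_le_mul {σ : ℝ} (hσ : σ = 1 ∨ σ = -1) {α : Type*} (s : Finset α) (f : α → Poly2) {η : ℕ}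
    (hf : ∀ x ∈ s, (Eset σ (f x)).card ≤ η) : (Eset σ (∏ x ∈ s, f x)).card ≤ s.card * η := by
  induction s using Finset.induction_on with
  | empty => rw [Finset.prod_empty, ← MvPolynomial.C_1, Eset_C]; simp
  | @insert a s ha ih =>
    rw [Finset.prod_insert ha, Finset.card_insert_of_notMem ha, Nat.succ_mul]
    have h1 := hf a (Finset.mem_insert_self a s)
    have h2 := ih fun x hx => hf x (Finset.mem_insert_of_mem hx)
    have h3 := card_Eset_mul_le hσ (f a) (∏ x ∈ s, f x)
    omega

/-! ### §3 Flag Wronskians of units: factorisation and edge count -/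

/-- ★ **Factorisation:** `W_D(U_{b₀},…,U_{b_{i−1}}) = (Π_c U_{b_c}) · det (P_j(b_c))_{j,c}`. [folklore] -/
theorem wronskian_units_eq (M v : Poly2) {ι : Type*} (U L : ι → Poly2) (hUL : ∀ k, M * jac (U k) v = U k * L k) {i : ℕ}
    (b : Fin i → ι) :
    wronskian (⇑(unitDer M v)) (U ∘ b) =
      (∏ c, U (b c)) * (Matrix.of fun (j c : Fin i) => unitIter M v (L (b c)) (j : ℕ)).det := by
  rw [wronskian_def, ← Matrix.det_mul_row]
  congr 1
  ext j c
  rw [wronskianMatrix_apply, Matrix.of_apply, Matrix.of_apply, Function.comp_apply,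
    iterate_unitDer M v (U (b c)) (L (b c)) (hUL (b c)), mul_comm]

/-- THE FLAG-WRONSKIAN EDGE BOUND `wEB t μ ℓ η i = i·η + (i!·(ℓ+μt+1)^{i·i})²`. -/
def wEB (t μ ℓ η i : ℕ) : ℕ := i * η + (i.factorial * (ℓ + μ * t + 1) ^ (i * i)) ^ 2

/-- ★ **Flag Wronskians of tame units are tame:** `|Eset σ W_D(U_{b₀},…,U_{b_{i−1}})| ≤ wEB t μ ℓ η i`. [folklore] -/
theorem card_Eset_wronskian_units_le {σ : ℝ} (hσ : σ = 1 ∨ σ = -1) {v M : Poly2} {t μ ℓ η : ℕ} (hvt : v.support.card ≤ t)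
    (hμ : M.support.card ≤ μ) {ι : Type*} (U L : ι → Poly2) (hUL : ∀ k, M * jac (U k) v = U k * L k)
    (hL : ∀ k, (L k).support.card ≤ ℓ) (hη : ∀ k, (Eset σ (U k)).card ≤ η) {i : ℕ} (b : Fin i → ι) :
    (Eset σ (wronskian (⇑(unitDer M v)) (U ∘ b))).card ≤ wEB t μ ℓ η i := by
  rw [wronskian_units_eq M v U L hUL b, wEB]
  have h1 : (Eset σ (∏ c, U (b c))).card ≤ i * η := by
    have h := card_Eset_prod_le_mul hσ Finset.univ (fun c => U (b c)) (fun c _ => hη (b c))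
    rwa [Finset.card_univ, Fintype.card_fin] at h
  have hQ : ∀ a c : Fin i, ((Matrix.of fun (j c : Fin i) => unitIter M v (L (b c)) (j : ℕ)) a c).support.card ≤ (ℓ + μ * t + 1) ^ i := by
    intro a c
    rw [Matrix.of_apply]
    exact (card_support_unitIter_le hvt hμ (hL (b c)) a).trans
      ((Nat.pow_le_pow_left (Nat.le_succ _) _).trans (Nat.pow_le_pow_right (Nat.succ_pos _) a.isLt.le))
  have h2 := card_supp_det_le _ hQ
  rw [Fintype.card_fin, ← pow_mul] at h2
  have h3 := card_Eset_le_sq σ _ h2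
  have h4 := card_Eset_mul_le hσ (∏ c, U (b c)) ((Matrix.of fun (j c : Fin i) => unitIter M v (L (b c)) (j : ℕ)).det)
  rw [pow_two]
  omega

/-! ### §4 The Sylvester step in shifted form and the adaptive flag ladder -/

/-- ★ **The Sylvester identity, shifted form:** `M·(W(f⃗,g)·J(W(f⃗,h),v) − W(f⃗,h)·J(W(f⃗,g),v)) = W(f⃗)·W(f⃗,g,h)` for `D = M·J(·,v)`
(✓ `wronskian_sylvester`). [folklore] -/
theorem wronskian_shift_identity (M v : Poly2) {n : ℕ} (f : Fin n → Poly2) (g h : Poly2) :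
    M * (wronskian (⇑(unitDer M v)) (Fin.snoc f g : Fin (n + 1) → Poly2) *
          jac (wronskian (⇑(unitDer M v)) (Fin.snoc f h : Fin (n + 1) → Poly2)) v -
        wronskian (⇑(unitDer M v)) (Fin.snoc f h : Fin (n + 1) → Poly2) *
          jac (wronskian (⇑(unitDer M v)) (Fin.snoc f g : Fin (n + 1) → Poly2)) v) =
      wronskian (⇑(unitDer M v)) f *
        wronskian (⇑(unitDer M v)) (Fin.snoc (Fin.snoc f g : Fin (n + 1) → Poly2) h : Fin (n + 2) → Poly2) := by
  have hs := wronskian_sylvester (unitDer M v) f g h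
  rw [unitDer_apply, unitDer_apply] at hs
  linear_combination (-1 : Poly2) * hs

/-- THE FLAG LADDER BOUND: `flagBound t B i n` bounds `|Eset σ W(U_{b₀..b_{i−1}}, E)|` when at most `n` indices of `K` are outside the flag and every flag Wronskian of
length `j` has `≤ B j` edge slopes; one step costs `3(t²+t) + 3·B(i+1) + B(i) + 2` (`Xc`, `Eset W_{i+1}`, `SpecShift`, `Eset W_i`). -/
def flagBound (t : ℕ) (B : ℕ → ℕ) : ℕ → ℕ → ℕ
  | _, 0 => 0
  | i, n + 1 => 3 * (t * t + t) + 3 * B (i + 1) + B i + 2 + flagBound t B (i + 1) n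

/-- ★ **THE ADAPTIVE FLAG LADDER** (abstract in the family). Chart `σ`, non-constant `t`-sparse `v`, `M ≠ 0`, `D = M·J(·,v)`, ANY family `U` whose flag Wronskians
`W_D(U∘b)` (`b : Fin j → ι`) have `≤ B j` edge slopes, `D`-constant coefficients `aₖ` (`J(aₖ,v) = 0`), `E = Σ_{k∈K} Uₖ·aₖ`.  For every flag `b : Fin i → ι` with
`W(U∘b) ≠ 0` and at most `n` indices of `K` off the flag, `|Eset σ W(U∘b, E)| ≤ flagBound t B i n`. -/
theorem card_Eset_flag_le {σ : ℝ} (hσ : σ = 1 ∨ σ = -1) {v M : Poly2} {t : ℕ} (hv : (S1 v).Nonempty)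
    (hvt : v.support.card ≤ t) (hM : M ≠ 0) {ι : Type*} (U : ι → Poly2) (B : ℕ → ℕ)
    (hB : ∀ (j : ℕ) (b : Fin j → ι), (Eset σ (wronskian (⇑(unitDer M v)) (U ∘ b))).card ≤ B j)
    (K : Finset ι) (a : ι → Poly2) (ha : ∀ k ∈ K, jac (a k) v = 0) :
    ∀ (n i : ℕ) (b : Fin i → ι), (K.filter (fun k => ∀ c, b c ≠ k)).card ≤ n →
      wronskian (⇑(unitDer M v)) (U ∘ b) ≠ 0 →
      (Eset σ (wronskian (⇑(unitDer M v))
        (Fin.snoc (U ∘ b) (∑ k ∈ K, U k * a k) : Fin (i + 1) → Poly2))).card ≤ flagBound t B i n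
  | 0, i, b, hK, _ => by
    -- every index of `K` is on the flag: all columns repeat, `F = 0`
    have hexp := wronskian_snoc_sum (unitDer M v) (U ∘ b) K U a (fun k hk => unitDer_eq_zero M v (ha k hk))
    have hzero : ∀ k ∈ K, wronskian (⇑(unitDer M v)) (Fin.snoc (U ∘ b) (U k) : Fin (i + 1) → Poly2) = 0 := by
      intro k hk
      have hk' : ¬ ∀ c, b c ≠ k := by
        intro hall
        have hmem : k ∈ K.filter (fun k => ∀ c, b c ≠ k) := Finset.mem_filter.mpr ⟨hk, hall⟩
        rw [Finset.card_eq_zero.mp (Nat.le_zero.mp hK)] at hmem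
        exact Finset.notMem_empty k hmem
      push Not at hk'
      obtain ⟨c, hc⟩ := hk'
      exact wronskian_snoc_eq_zero_of_eq (unitDer M v) (U ∘ b) (a := c) (by rw [Function.comp_apply, hc])
    have h0 : wronskian (⇑(unitDer M v)) (Fin.snoc (U ∘ b) (∑ k ∈ K, U k * a k) : Fin (i + 1) → Poly2) = 0 := by
      rw [hexp]
      exact Finset.sum_eq_zero fun k hk => by rw [hzero k hk, mul_zero]
    rw [h0, Eset_zero]
    simp [flagBound]
  | n + 1, i, b, hK, hWb => by
    show _ ≤ 3 * (t * t + t) + 3 * B (i + 1) + B i + 2 + flagBound t B (i + 1) n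
    have hexp := wronskian_snoc_sum (unitDer M v) (U ∘ b) K U a (fun k hk => unitDer_eq_zero M v (ha k hk))
    by_cases hall : ∀ k ∈ K, wronskian (⇑(unitDer M v)) (Fin.snoc (U ∘ b) (U k) : Fin (i + 1) → Poly2) = 0
    · have h0 : wronskian (⇑(unitDer M v)) (Fin.snoc (U ∘ b) (∑ k ∈ K, U k * a k) : Fin (i + 1) → Poly2) = 0 := by
        rw [hexp]
        exact Finset.sum_eq_zero fun k hk => by rw [hall k hk, mul_zero]
      rw [h0, Eset_zero]
      simp
    push Not at hall
    obtain ⟨k₀, hk₀, hW'⟩ := hall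
    -- the new pivot is off the flag
    have hb : ∀ c, b c ≠ k₀ := fun c hc =>
      hW' (wronskian_snoc_eq_zero_of_eq (unitDer M v) (U ∘ b) (a := c) (by rw [Function.comp_apply, hc]))
    have hcomp : U ∘ (Fin.snoc b k₀ : Fin (i + 1) → ι) = Fin.snoc (U ∘ b) (U k₀) := Fin.comp_snoc U b k₀
    -- the Sylvester step, shifted form, into the shifted-axial template
    have hid := wronskian_shift_identity M v (U ∘ b) (U k₀) (∑ k ∈ K, U k * a k)
    have hsub := Eset_subset_of_shifted hσ hv hW' hM hid
    -- sizes
    have hX : (Xc σ v).card ≤ t * t + t := (card_Xc_le σ v).trans (Nat.add_le_add (Nat.mul_le_mul hvt hvt) hvt)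
    have hW'E : (Eset σ (wronskian (⇑(unitDer M v)) (Fin.snoc (U ∘ b) (U k₀) : Fin (i + 1) → Poly2))).card ≤ B (i + 1) := by
      have h := hB (i + 1) (Fin.snoc b k₀ : Fin (i + 1) → ι)
      rwa [hcomp] at h
    have hWbE : (Eset σ (wronskian (⇑(unitDer M v)) (U ∘ b))).card ≤ B i := hB i b
    have hSS := card_SpecShift_le' hσ v (wronskian (⇑(unitDer M v)) (Fin.snoc (U ∘ b) (U k₀) : Fin (i + 1) → Poly2))
      (wronskian (⇑(unitDer M v)) (Fin.snoc (U ∘ b) (∑ k ∈ K, U k * a k) : Fin (i + 1) → Poly2))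
    -- the longer flag: one index fewer off it
    have hK' : (K.filter (fun k => ∀ c, (Fin.snoc b k₀ : Fin (i + 1) → ι) c ≠ k)).card ≤ n := by
      have hsub' : K.filter (fun k => ∀ c, (Fin.snoc b k₀ : Fin (i + 1) → ι) c ≠ k) ⊆ (K.filter (fun k => ∀ c, b c ≠ k)).erase k₀ := by
        intro k hk
        obtain ⟨hkK, hall⟩ := Finset.mem_filter.mp hk
        refine Finset.mem_erase.mpr ⟨fun hkk => hall (Fin.last i) (by rw [Fin.snoc_last, hkk]), Finset.mem_filter.mpr ⟨hkK, fun c hc => ?_⟩⟩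
        exact hall c.castSucc (by rw [Fin.snoc_castSucc, hc])
      have hmem : k₀ ∈ K.filter (fun k => ∀ c, b c ≠ k) := Finset.mem_filter.mpr ⟨hk₀, hb⟩
      have hcard := Finset.card_le_card hsub'
      rw [Finset.card_erase_of_mem hmem] at hcard
      omega
    have hWb' : wronskian (⇑(unitDer M v)) (U ∘ (Fin.snoc b k₀ : Fin (i + 1) → ι)) ≠ 0 := by rw [hcomp]; exact hW'
    have hrec := card_Eset_flag_le hσ hv hvt hM U B hB K a ha n (i + 1) (Fin.snoc b k₀) hK' hWb'
    rw [hcomp] at hrec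
    have hc := (Finset.card_le_card hsub).trans
      ((Finset.card_union_le _ _).trans (Nat.add_le_add
        ((Finset.card_union_le _ _).trans (Nat.add_le_add (Finset.card_union_le _ _) le_rfl))
        (Finset.card_union_le _ _)))
    omega

/-- ★★ **THE WRONSKIAN LADDER.** With the data of ✓ `card_Eset_unitSum_le` but `D`-CONSTANT coefficients `aₖ` of any size (`J(aₖ,v) = 0`: constants
`C c` by ✓ `jac_C_left`, or `ψ(v)` by ✓ `jac_aeval_self`), and no `Uₖ ≠ 0` needed: `|Eset σ (Σ_{k∈K} Uₖ·aₖ)| ≤ flagBound t (wEB t μ ℓ η) 0 r` for `|K| ≤ r`. -/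
theorem card_Eset_unitSumW_le {σ : ℝ} (hσ : σ = 1 ∨ σ = -1) {v M : Poly2} {t μ ℓ η : ℕ} (hv : (S1 v).Nonempty)
    (hvt : v.support.card ≤ t) (hM : M ≠ 0) (hμ : M.support.card ≤ μ) {ι : Type*} (U L : ι → Poly2)
    (hUL : ∀ k, M * jac (U k) v = U k * L k) (hL : ∀ k, (L k).support.card ≤ ℓ)
    (hη : ∀ k, (Eset σ (U k)).card ≤ η) (K : Finset ι) (a : ι → Poly2) (ha : ∀ k ∈ K, jac (a k) v = 0) {r : ℕ}
    (hK : K.card ≤ r) : (Eset σ (∑ k ∈ K, U k * a k)).card ≤ flagBound t (wEB t μ ℓ η) 0 r := by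
  have h := card_Eset_flag_le hσ hv hvt hM U (wEB t μ ℓ η) (fun j b => card_Eset_wronskian_units_le hσ hvt hμ U L hUL hL hη b) K a ha r 0
    (fun c => c.elim0) ((Finset.card_filter_le _ _).trans hK)
    (by rw [wronskian_fin_zero]; exact one_ne_zero)
  rwa [wronskian_fin_one] at h

end Summit.ValiantsHypothesis.ValiantsHypothesis.Theorems.TwoProducts.RankTwoJacobian

end
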